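import Summits.QuantumFields.YangMills.Theorems.FluctuationComparisonRegPrIntLS1aAlphaMemCanonVersionOfRows
import Literature.MathematicalPhysics.QuantumFieldTheory.Balaban1983to89.T3AlphaInputsACTrivRows
import HarnessLib

/-!
# S1a · UV3-NODE §69.10 — THE (m2) DOOR FED BY NAME FROM `AlphaInputsT3ACFullTriv`: remaining binders = `hwin`, `hlowc`∕`hupc`, `hRegClass` (δ2-b), LF ×2

Cell `ym3-torus` (YM ladder rung R3 = continuum `SU(2)` Yang–Mills on the three-torus — a RUNG: NOT d = 4, NOT infinite volume, NOT a mass gap, NOT Clay).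
Width seat «width 8» `ym3-torus-px8` (gen 23), FREE px helper on crux `stmt-QuantumFields-20520`, count-neutral, DEFINITION-FREE, default heartbeats; the wrapper of ✓p822781
`…S1aAlphaMemCanonVersionOfRows.mem_canonVersion_of_alphaRows` over the (α)-socket part 4 `T3AlphaInputsACTrivRows` (the six trivial-history interface rows + the additive
package `AlphaInputsT3ACFullTriv`): every displayed interface binder (δ8 `hχ1`, R0 `hR0`, Z0 `hZ`, X⊂X̃ `hsub`, δ1 `hBU`, δ4 `hDiam`) and every typed (α) schema is now read off ONE
package name; what remains displayed is EXACTLY `hwin` (§67.3 (c)), `hlowc`∕`hupc` (δ7 proper), `hRegClass` (δ2-b, UNPRINTED G-K1a-1, deleted by the (R-β1′)+δ2-a substrate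
landing via ✓p821267) and the LF lane's `hlfle`∕`hlarge`.  Nothing of Bałaban's is asserted or proved; the package for the actual runs is UNINHABITED; 20520 ∕ `YM3TorusSU2` NOT
proved.  Sorry-free, axioms standard.  References: T. Bałaban, CMP **102** (1985) 255–275 [Balaban1985UV3] ((24) p.262, (41)–(47) pp.266–267).
-/

set_option autoImplicit false

noncomputable section

namespace Summit.QuantumFields.YangMills.Theorems.FluctuationComparisonRegPrIntLS1aAlphaMemOfFullTriv

open MeasureTheory
open Literature.MathematicalPhysics.QuantumFieldTheory.Balaban1983to89
open T3ContinuumYM3Torus T3UnitScaleTilt T3UnitLawDensityEML T3RestrictedUnitDensity T3AlphaInputsAC T3AlphaInputsACSchemas T3AlphaInputsACTrivRows BalabanUVClass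
open Literature.MathematicalPhysics.QuantumFieldTheory.Balaban1983to89.Node00 (regSet canonVersion)
open Literature.MathematicalPhysics.QuantumFieldTheory.Balaban1983to89.T3OrbitAverage (orbAvg)
open Summit.QuantumFields.YangMills.Theorems.FluctuationComparisonRegPrIntLS1aAlphaMemCanonVersionOfRows (mem_canonVersion_of_alphaRows)

variable {F : T3Family} {γ : ℝ} {D : AlphaDataT3 F γ}

/-- ★★★ **THE (m2) DOOR FROM ONE PACKAGE NAME**: under `AlphaInputsT3ACFullTriv D W b₀ p₀ ε₀ C68 Cχ B₃ M₁ r CD` (+ `0 ≤ r`, `1 ≤ M₁`, `M₁ ∣ 2L^m`, `0 ≤ CD`, `0 ≤ γ`), the Γ-averaged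
canonical version of `e^{E_k}·ρ_k` is a class member at level `k ≤ K` of run `K` for SOME `(C, κ₁, C′)` of the package, the remaining binders being `hwin`, `hlowc`, `hupc`,
`hRegClass`, `hlfle`, `hlarge`. [cite: Balaban1985UV3, (41)-(47) pp.266-267 and (24) p.262] -/
theorem mem_canonVersion_of_alphaFullTriv (W : LFData D) {b₀ p₀ ε₀ C68 Cχ B₃ r CD δreg δL cLF c5 : ℝ} {M₁ : ℕ} {K k : ℕ} (hk : k ≤ K)
    (h : AlphaInputsT3ACFullTriv D W b₀ p₀ ε₀ C68 Cχ B₃ M₁ r CD) (hr : 0 ≤ r) (hM1 : 1 ≤ M₁) (hMdvd : M₁ ∣ 2 * F.L ^ F.m) (hCD : 0 ≤ CD) (hγ : 0 ≤ γ)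
    (hwin : {V : GaugeField (F.P K) k (Matrix.specialUnitaryGroup (Fin 2) ℂ) | PlaqSmall (θBal F.L γ b₀ p₀ (K - k)) V} ⊆
      regSet (fieldMeasure (F.P K) k (Matrix.specialUnitaryGroup (Fin 2) ℂ)) (resDensity F γ K Set.univ k))
    (hlowc : ContinuousOn (D.low K k) {V | PlaqSmall (θBal F.L γ b₀ p₀ (K - k)) V})
    (hupc : ContinuousOn (D.up K k) {V | PlaqSmall (θBal F.L γ b₀ p₀ (K - k)) V})
    (hRegClass : ∀ V : GaugeField (F.P K) k (Matrix.specialUnitaryGroup (Fin 2) ℂ), PlaqSmall (θBal F.L γ b₀ p₀ (K - k)) V →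
      IsBackground (fun i => BlockAveraging.blockAvg (P := F.P K) (j := i) ℰp) {U | PlaqSmall δreg U} k V (D.Umin K k (D.triv K k) V))
    (hlfle : ∀ V : GaugeField (F.P K) k (Matrix.specialUnitaryGroup (Fin 2) ℂ),
      Real.exp (D.Ecst K k) * (Real.exp (-(D.Ecst K k) + D.Rm K k) * (D.up K k V - D.low K k V)) ≤
        Real.exp (-cLF) * Real.exp (c5 * Fintype.card (Site (F.P K) k)))
    (hlarge : ∀ (V : GaugeField (F.P K) k (Matrix.specialUnitaryGroup (Fin 2) ℂ)) (S : Finset (Plaq (F.P K) k)),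
      (∀ p ∈ S, δL ≤ GaugeGroup.dist1 (GaugeField.plaqHol V p)) →
        Real.exp (D.Ecst K k) *
            canonVersion (fieldMeasure (F.P K) k (Matrix.specialUnitaryGroup (Fin 2) ℂ)) (orbAvg (resDensity F γ K Set.univ k)) V ≤
          Real.exp (-(cLF * S.card)) * Real.exp (c5 * Fintype.card (Site (F.P K) k))) :
    ∃ C κ₁ C' : ℝ, Mem (P := F.P K) (k := k) (fun i => BlockAveraging.blockAvg (P := F.P K) (j := i) ℰp)
      { δ := θBal F.L γ b₀ p₀ (K - k), δreg := δreg, δL := δL, β := (F.scheme ℰp γ).β K, κ := κ₁, M := 2 * r + 18 * M₁ + 3 + CD,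
        Ccov := max C 0 * θBal F.L γ b₀ p₀ (K - k + 1) ^ 2 * (2 * max C' 0 * (7 + 2 * r + 18 * M₁) ^ 3), cE := 0, slack := D.Rm K k,
        cLF := cLF, c5 := c5 }
      (fun V => Real.exp (D.Ecst K k) *
        canonVersion (fieldMeasure (F.P K) k (Matrix.specialUnitaryGroup (Fin 2) ℂ)) (orbAvg (resDensity F γ K Set.univ k)) V) := by
  have hA := h.base
  obtain ⟨κ₁, C, C', hts, hLC⟩ := h.commonRate
  exact ⟨C, κ₁, C', mem_canonVersion_of_alphaRows D W hk hA.1.2.1 hA.1.2.2.1 hts hA.1.1 hA.admOnSmall hLC h.enlBounded h.locBlockVolume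
    hA.2.2.2.2.2.1.2.1 hA.2.2.1 h.full.2.1 (hA.ineq47AE hk) (hA.ineq41AE hk) hr hM1 hMdvd hCD hγ hwin hlowc hupc
    (fun V hV => h.chiOneOnSmall K k V hk hV) (fun V v => h.trivWeight K k v V) (h.ztermTriv K k)
    (fun i _ _ Y hY => h.locBlockUnion K k (D.triv K k) i Y hY) (fun i _ _ Y hY x hx y hy => h.locDiam K k (D.triv K k) i Y hY x hx y hy)
    h.enlContains hRegClass hlfle hlarge⟩


end Summit.QuantumFields.YangMills.Theorems.FluctuationComparisonRegPrIntLS1aAlphaMemOfFullTriv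

end
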